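import Summits.NavierStokesRegularity.FunctionalMining.TopEigChartCalculus
import Mathlib.MeasureTheory.Integral.DivergenceTheorem
import HarnessLib

/-!
# FunctionalMining — Gauss–Green for the torus Laplacian on chart BOXES: `∫_B ΔΛ∘ch = ∑ faces (flux
# of ∂ᵢΛ)`, and the local chain rule `Δ(φ^q)` at a point

Search for candidate a priori estimates; no regularity claim. Cell `pub-nsfunc`, prove seat
(gen 23). Tools for the region-by-region form of F1 PART I's density identity (Cor. 3′ (b), Prop. 4
(3)): Mathlib's divergence theorem on rectangular boxes
(`MeasureTheory.integral_divergence_of_hasFDerivAt_off_countable'`) read through the chart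
`ch w = x₀ + proj w` of `T³` for the vector field `(∂ᵢΛ∘ch)ᵢ`, whose divergence is `ΔΛ∘ch` wherever
the lift of `Λ` is `C²`:

* `TopEig.contDiffAt_liftAt_add_proj` — chart shift (converse of `contDiffAt_liftAt_of_shift`);
* `TopEig.contDiffAt_liftAt_partialDeriv` — where `liftAt Λ x₀` is `C^∞`, the lift of `∂ᵢΛ` is
  `z ↦ D(liftAt Λ x₀)(z)eᵢ` nearby, hence `C^∞`, and `∂ᵢ∂ᵢΛ(x₀ + proj w) = D(liftAt (∂ᵢΛ) x₀)(w)eᵢ`;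
* **`TopEig.setIntegral_box_laplacian_eq_flux`** — if `liftAt Λ x₀` is `C^∞` at every point of a box
  `[a, b] ⊂ ℝ³` then `w ↦ ΔΛ(x₀ + proj w)` is integrable on the box and
  `∫_{[a,b]} ΔΛ∘ch = ∑ᵢ (∫_{face i} ∂ᵢΛ∘ch∘frontᵢ − ∫_{face i} ∂ᵢΛ∘ch∘backᵢ)`;
* `TopEig.laplacian_rpow_of_pos_at` — for `φ` smooth on the torus and `φ(x) > 0`:
  `Δ(φ^q)(x) = q(q−1)φ^{q−2}∑ₖ(∂ₖφ)² + qφ^{q−1}Δφ` AT THE POINT (the tree's `laplacian_rpow_of_pos`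
  needs `φ > 0` everywhere).

[folklore]
-/

noncomputable section

open MeasureTheory Set Filter Topology Matrix Finset
open scoped ContDiff

namespace Summit.NavierStokesRegularity.FunctionalMining

open Literature.Analysis Literature.Analysis.FunctionSpaces Literature.Analysis.FunctionSpaces.Torus

namespace TopEig

/-! ## 1. Chart lemmas -/

/-- **Chart shift, converse**: smoothness of `liftAt f x` at `w` gives smoothness of
`liftAt f (x + proj w)` at `0`. [folklore] -/
theorem contDiffAt_liftAt_add_proj {F : Type*} [NormedAddCommGroup F] [NormedSpace ℝ F]
    {d : Type*} [Fintype d] {n : WithTop ℕ∞} {f : UnitAddTorus d → F} {x : UnitAddTorus d}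
    {w : EuclideanSpace ℝ d} (h : ContDiffAt ℝ n (liftAt f x) w) :
    ContDiffAt ℝ n (liftAt f (x + proj w)) 0 := by
  rw [liftAt_add_proj]
  have h' : ContDiffAt ℝ n (liftAt f x) ((fun z : EuclideanSpace ℝ d => w + z) 0) := by
    rw [show (fun z : EuclideanSpace ℝ d => w + z) 0 = w by simp]
    exact h
  exact h'.comp 0 (contDiff_const.add contDiff_id).contDiffAt

/-- Near a point of the chart where the lift `g` of a torus function is `C^∞`, the lift of its
`i`-th torus partial derivative is `z ↦ Dg(z) eᵢ`; hence it is `C^∞` there too, and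
`∂ᵢ∂ᵢ f(x₀ + proj w) = D(lift of ∂ᵢf)(w) eᵢ`. [folklore] -/
theorem contDiffAt_liftAt_partialDeriv {d : Type*} [Fintype d] [DecidableEq d]
    {f : UnitAddTorus d → ℝ} {x₀ : UnitAddTorus d}
    {w : EuclideanSpace ℝ d} (hg : ContDiffAt ℝ ∞ (liftAt f x₀) w) (i : d) :
    ContDiffAt ℝ ∞ (liftAt (Torus.partialDeriv i f) x₀) w ∧
      Torus.partialDeriv i f (x₀ + proj w) =
        fderiv ℝ (liftAt f x₀) w (EuclideanSpace.single i (1 : ℝ)) ∧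
      Torus.partialDeriv i (Torus.partialDeriv i f) (x₀ + proj w) =
        fderiv ℝ (liftAt (Torus.partialDeriv i f) x₀) w (EuclideanSpace.single i (1 : ℝ)) := by
  have hg1 : ContDiffAt ℝ 1 (liftAt f x₀) w := hg.of_le (by simp)
  have hdiff : ∀ᶠ z in 𝓝 w, DifferentiableAt ℝ (liftAt f x₀) z := by
    filter_upwards [hg1.eventually (by simp)] with z hz
    exact hz.differentiableAt (by simp)
  have heq : liftAt (Torus.partialDeriv i f) x₀ =ᶠ[𝓝 w]
      fun z => fderiv ℝ (liftAt f x₀) z (EuclideanSpace.single i (1 : ℝ)) := by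
    filter_upwards [hdiff] with z hz
    rw [liftAt_apply]
    exact partialDeriv_eq_fderiv_liftAt hz i
  have hD : ContDiffAt ℝ ∞ (fun z => fderiv ℝ (liftAt f x₀) z (EuclideanSpace.single i (1 : ℝ))) w :=
    (hg.fderiv_right (m := ∞) le_rfl).clm_apply contDiffAt_const
  have h1 : ContDiffAt ℝ ∞ (liftAt (Torus.partialDeriv i f) x₀) w := hD.congr_of_eventuallyEq heq
  refine ⟨h1, partialDeriv_eq_fderiv_liftAt hdiff.self_of_nhds i, ?_⟩
  exact partialDeriv_eq_fderiv_liftAt (h1.differentiableAt (by simp)) i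

/-! ## 2. Gauss–Green for the torus Laplacian on a chart box -/

/-- **`∫_B ΔΛ∘ch = ∑ faces (flux of ∂ᵢΛ)` ON A CHART BOX.** Let `Λ : T³ → ℝ` and `x₀ ∈ T³` be such
that the lift `liftAt Λ x₀` is `C^∞` at every point of the box `[a, b] ⊂ ℝ³` (`a ≤ b`). Then
`w ↦ ΔΛ(x₀ + proj w)` is integrable on `[a, b]` and
`∫_{[a,b]} ΔΛ(x₀ + proj w) dw = ∑ᵢ (∫_{face i} ∂ᵢΛ(x₀ + proj(frontᵢ z)) dz − ∫_{face i} ∂ᵢΛ(x₀ + proj(backᵢ z)) dz)`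
(`frontᵢ`, `backᵢ` insert `bᵢ`, `aᵢ` as the `i`-th coordinate; `∂ᵢ` the torus partial derivative).
[folklore — divergence theorem] -/
theorem setIntegral_box_laplacian_eq_flux {Λ : UnitAddTorus (Fin 3) → ℝ} (x₀ : UnitAddTorus (Fin 3))
    {a b : Fin 3 → ℝ} (hab : a ≤ b)
    (hΛ : ∀ w ∈ Icc a b, ContDiffAt ℝ ∞ (liftAt Λ x₀) (WithLp.toLp 2 w)) :
    IntegrableOn (fun w : Fin 3 → ℝ => Torus.laplacian Λ (x₀ + proj (WithLp.toLp 2 w))) (Icc a b) ∧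
      ∫ w in Icc a b, Torus.laplacian Λ (x₀ + proj (WithLp.toLp 2 w)) =
        ∑ i : Fin 3,
          ((∫ z in Icc (a ∘ i.succAbove) (b ∘ i.succAbove),
              Torus.partialDeriv i Λ (x₀ + proj (WithLp.toLp 2 (i.insertNth (b i) z)))) -
            ∫ z in Icc (a ∘ i.succAbove) (b ∘ i.succAbove),
              Torus.partialDeriv i Λ (x₀ + proj (WithLp.toLp 2 (i.insertNth (a i) z)))) := by
  set L : (Fin 3 → ℝ) →L[ℝ] EuclideanSpace ℝ (Fin 3) :=
    ((EuclideanSpace.equiv (Fin 3) ℝ).symm : (Fin 3 → ℝ) →L[ℝ] EuclideanSpace ℝ (Fin 3)) with hL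
  have hLapply : ∀ w : Fin 3 → ℝ, L w = WithLp.toLp 2 w := fun w => rfl
  -- the vector field `f i = ∂ᵢΛ ∘ ch` and its derivative
  set f : Fin 3 → (Fin 3 → ℝ) → ℝ := fun i w => liftAt (Torus.partialDeriv i Λ) x₀ (WithLp.toLp 2 w)
    with hfdef
  set f' : Fin 3 → (Fin 3 → ℝ) → (Fin 3 → ℝ) →L[ℝ] ℝ :=
    fun i w => (fderiv ℝ (liftAt (Torus.partialDeriv i Λ) x₀) (WithLp.toLp 2 w)) ∘L L with hf'def
  have Hc : ∀ i, ContinuousOn (f i) (Icc a b) := by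
    intro i w hw
    have h1 := (contDiffAt_liftAt_partialDeriv (hΛ w hw) i).1
    have hc : ContinuousAt (liftAt (Torus.partialDeriv i Λ) x₀) (L w) := by
      rw [hLapply]; exact h1.continuousAt
    exact (hc.comp L.continuous.continuousAt).continuousWithinAt
  have Hd : ∀ w ∈ (Set.pi Set.univ fun i => Ioo (a i) (b i)) \ (∅ : Set (Fin 3 → ℝ)), ∀ i,
      HasFDerivAt (f i) (f' i w) w := by
    intro w hw i
    have hwB : w ∈ Icc a b := by
      have h := hw.1
      rw [Set.mem_pi] at h
      exact ⟨fun j => (h j (Set.mem_univ j)).1.le, fun j => (h j (Set.mem_univ j)).2.le⟩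
    have h1 := (contDiffAt_liftAt_partialDeriv (hΛ w hwB) i).1
    have hd : DifferentiableAt ℝ (liftAt (Torus.partialDeriv i Λ) x₀) (L w) := by
      rw [hLapply]; exact h1.differentiableAt (by simp)
    exact hd.hasFDerivAt.comp w L.hasFDerivAt
  -- the divergence is `ΔΛ ∘ ch`, continuous on the box
  have hdiv_pt : ∀ w ∈ Icc a b, ∑ i, f' i w (Pi.single i 1) =
      Torus.laplacian Λ (x₀ + proj (WithLp.toLp 2 w)) := by
    intro w hw
    have h2 : ContDiffAt ℝ 2 (liftAt Λ (x₀ + proj (WithLp.toLp 2 w))) 0 :=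
      (contDiffAt_liftAt_add_proj (hΛ w hw)).of_le (WithTop.coe_le_coe.2 le_top)
    rw [laplacian_eq_sum_partialDeriv_partialDeriv_of_contDiffAt h2]
    refine Finset.sum_congr rfl fun i _ => ?_
    rw [(contDiffAt_liftAt_partialDeriv (hΛ w hw) i).2.2]
    simp only [hf'def, ContinuousLinearMap.comp_apply, hLapply]
    rfl
  have hdiv_cont : ContinuousOn (fun w => ∑ i, f' i w (Pi.single i 1)) (Icc a b) := by
    refine continuousOn_finsetSum _ fun i _ => ?_
    intro w hw
    have h1 := (contDiffAt_liftAt_partialDeriv (hΛ w hw) i).1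
    have hc : ContinuousAt (fderiv ℝ (liftAt (Torus.partialDeriv i Λ) x₀)) (L w) := by
      rw [hLapply]; exact h1.continuousAt_fderiv (by simp)
    have hc' : ContinuousAt (fun w' : Fin 3 → ℝ =>
        fderiv ℝ (liftAt (Torus.partialDeriv i Λ) x₀) (L w') (L (Pi.single i 1))) w :=
      ((hc.comp L.continuous.continuousAt).clm_apply continuousAt_const)
    exact hc'.continuousWithinAt
  have Hi : IntegrableOn (fun w => ∑ i, f' i w (Pi.single i 1)) (Icc a b) :=
    hdiv_cont.integrableOn_compact isCompact_Icc
  have hDT := MeasureTheory.integral_divergence_of_hasFDerivAt_off_countable' (n := 2) a b hab f f'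
    ∅ Set.countable_empty Hc Hd Hi
  rw [setIntegral_congr_fun measurableSet_Icc hdiv_pt] at hDT
  refine ⟨Hi.congr_fun hdiv_pt measurableSet_Icc, ?_⟩
  rw [hDT]
  rfl

/-! ## 3. `Δ(φ^q)` at a point where `φ > 0` -/

/-- **`Δ(φ^q)(x) = q(q−1)φ(x)^{q−2}∑ₖ(∂ₖφ(x))² + qφ(x)^{q−1}Δφ(x)`** for `φ` smooth on `T^d` and
`φ(x) > 0` (real `q`): the pointwise form of the tree's `laplacian_rpow_of_pos` (which asks `φ > 0`
everywhere). [folklore] -/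
theorem laplacian_rpow_of_pos_at {d : Type*} [Fintype d] [DecidableEq d] {φ : UnitAddTorus d → ℝ}
    (hφ : Torus.IsSmooth φ) {x : UnitAddTorus d} (hx : 0 < φ x) (q : ℝ) :
    Torus.laplacian (fun y => φ y ^ q) x =
      q * (q - 1) * φ x ^ (q - 2) * ∑ k, Torus.partialDeriv k φ x ^ 2 +
        q * φ x ^ (q - 1) * Torus.laplacian φ x := by
  -- `liftAt (φ^q) x = (liftAt φ x)^q` is `C²` at `0`
  have hl : ContDiffAt ℝ ∞ (liftAt φ x) 0 := (hφ.liftAt x).contDiffAt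
  have hne : liftAt φ x 0 ≠ 0 := by rw [liftAt_apply_zero]; exact hx.ne'
  have hlq : ContDiffAt ℝ 2 (liftAt (fun y => φ y ^ q) x) 0 :=
    (hl.rpow_const_of_ne (p := q) hne).of_le (WithTop.coe_le_coe.2 le_top)
  rw [laplacian_eq_sum_partialDeriv_partialDeriv_of_contDiffAt hlq,
    Torus.laplacian_eq_sum_partialDeriv_partialDeriv hφ x, Finset.mul_sum, Finset.mul_sum,
    ← Finset.sum_add_distrib]
  refine Finset.sum_congr rfl fun k _ => ?_
  -- the coordinate line through `x`
  have hdiff : ∀ᶠ u in 𝓝 (0 : ℝ), DifferentiableAt ℝ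
      (fun u : ℝ => φ (x + proj (u • EuclideanSpace.single k (1 : ℝ)))) u :=
    Eventually.of_forall fun u => (hasDerivAt_coordLine hφ x k u).differentiableAt
  have ha : HasDerivAt (fun u : ℝ => φ (x + proj (u • EuclideanSpace.single k (1 : ℝ))))
      (Torus.partialDeriv k φ x) 0 := by
    have h := hasDerivAt_coordLine hφ x k 0
    rw [coordLine_zero] at h
    exact h
  have hfun : deriv (fun u : ℝ => φ (x + proj (u • EuclideanSpace.single k (1 : ℝ)))) =
      fun u => Torus.partialDeriv k φ (x + proj (u • EuclideanSpace.single k (1 : ℝ))) :=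
    funext fun u => (hasDerivAt_coordLine hφ x k u).deriv
  have hb : HasDerivAt (deriv fun u : ℝ => φ (x + proj (u • EuclideanSpace.single k (1 : ℝ))))
      (Torus.partialDeriv k (Torus.partialDeriv k φ) x) 0 := by
    rw [hfun]
    have h := hasDerivAt_coordLine (hφ.partialDeriv k) x k 0
    rw [coordLine_zero] at h
    exact h
  have hpos : 0 < (fun u : ℝ => φ (x + proj (u • EuclideanSpace.single k (1 : ℝ)))) 0 := by
    show 0 < φ (x + proj ((0 : ℝ) • EuclideanSpace.single k (1 : ℝ)))
    rw [coordLine_zero]; exact hx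
  have H := hasDerivAt_deriv_rpow q hdiff ha hb hpos
  rw [partialDeriv_partialDeriv_eq_deriv_deriv, H.deriv]
  simp only [coordLine_zero]

end TopEig

end Summit.NavierStokesRegularity.FunctionalMining

end
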